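import Mathlib
import Literature.Analysis.ODE.LipschitzFlow
import Literature.Analysis.ODE.ComplexRiccatiJacobi

/-!
# The phase functions of a first-order Gaussian beam for `u_tt − u_xx + μ² q(x) u = 0`

Topic `Literature/Analysis/ODE` (namespace `Literature.Analysis.ODE`). Everything is proved; no
definitions.

A Gaussian beam (J. Ralston 1982, §2; for the wave equation on a Lorentzian manifold
J. Sbierski, Anal. PDE 8 (2015), §3) for the one-dimensional wave operator with a large potential
`P = ∂_t² − ∂_x² + μ² q(x)` is `a(t) e^{iμΦ(t,x)}`, `Φ = θ(t) + ξ(t)(x − X(t)) + ½Γ(t)(x − X(t))²`,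
whose μ-INDEPENDENT structure functions solve, at the fixed frequency `ω₀ = √(ξ² + q(X))`
(conserved): Hamilton's equations of `H = √(ξ² + q(x))`,

  `X' = ξ/ω₀`,  `ξ' = −q'(X)/(2ω₀)`,  `ξ² + q(X) ≡ ω₀²`      (`exists_beamTrajectory`),

the Riccati equation of the Hessian of the phase (beam form)

  `ω₀ Γ' = (ξ' − ΓX')² − Γ² − ½ q''(X)`,  `Im Γ > 0`,

the transport equation `2ω₀ a' = −((ξ' − ΓX')X' + Γ) a` and `θ' = −ω₀ + ξX'`.
`exists_beamPhase` produces all five functions on the whole line, of class `C²`, for `q ∈ C³`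
with Lipschitz `q'` (global Hamilton flow: `Literature.Analysis.ODE.exists_solution_real_of_lipschitz`;
Riccati with `Im Γ > 0`: `Literature.Analysis.ODE.exists_complexRiccati_im_pos_C2` with the
coefficients `A = q''(X)/(2ω₀) − q'(X)²/(4ω₀³)`, `B = −ξq'(X)/(2ω₀³)`, `C = q(X)/ω₀³` of the
linearised flow, converted to the beam form by the constraint; transport and `θ` by quadrature),
for REST data `ξ(0) = 0`, `Γ(0) = iβ₀` (`β₀ > 0`), `θ(0) = 0` — the case consumed by the rest
packets of `Literature/Analysis/PDE/GaussianBeam1D*.lean` — together with the exact values at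
`t = 0` that make the beam's time derivative vanish there (`X'(0) = 0`, `a'(0) = −iβ₀a₀/(2ω₀)`,
`Γ'(0)` real).

## References

* J. Ralston, *Gaussian beams and the propagation of singularities*, MAA Stud. Math. 23 (1982)
  206–248, §2. Key `Ralston1982`.
* J. Sbierski, Anal. PDE 8 (2015) 1379–1420, §3 (arXiv:1311.2477v2 §2.2). Key `Sbierski2015`.
-/

noncomputable section

namespace Literature.Analysis.ODE

open Set Filter Topology Complex
open scoped NNReal

variable {q : ℝ → ℝ}

/-! ### The bicharacteristic at fixed frequency -/

/-- **Global Hamilton flow at fixed frequency.** For `q ∈ C²` with Lipschitz `q'` and `ω₀ > 0`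
there are global `C²` solutions of `X' = ξ/ω₀`, `ξ' = −q'(X)/(2ω₀)` with any data, and
`ξ² + q(X)` is conserved. [cite: Ralston1982, §2; folklore (Hamilton's equations)] -/
theorem exists_beamTrajectory (hq : ContDiff ℝ 2 q) {K : ℝ≥0} (hK : LipschitzWith K (deriv q))
    {ω₀ : ℝ} (hω₀ : 0 < ω₀) (X₀ ξ₀ : ℝ) :
    ∃ X ξ : ℝ → ℝ, X 0 = X₀ ∧ ξ 0 = ξ₀ ∧
      (∀ t, HasDerivAt X (ξ t / ω₀) t) ∧ (∀ t, HasDerivAt ξ (-(deriv q (X t)) / (2 * ω₀)) t) ∧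
      (∀ t, ξ t ^ 2 + q (X t) = ξ₀ ^ 2 + q X₀) ∧ ContDiff ℝ 2 X ∧ ContDiff ℝ 2 ξ := by
  have hq1 : ContDiff ℝ 1 (deriv q) := hq.deriv'
  have hdq : ∀ x, HasDerivAt q (deriv q x) x := fun x =>
    (hq.differentiable (by norm_num) x).hasDerivAt
  -- the Hamiltonian field is globally Lipschitz
  set g : ℝ × ℝ → ℝ × ℝ := fun p => (p.2 / ω₀, -(deriv q p.1) / (2 * ω₀)) with hg
  have hL1 : LipschitzWith (Real.toNNReal (1 / ω₀)) fun p : ℝ × ℝ => p.2 / ω₀ := by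
    refine LipschitzWith.of_dist_le_mul fun p p' => ?_
    rw [Real.coe_toNNReal _ (by positivity), Real.dist_eq,
      show p.2 / ω₀ - p'.2 / ω₀ = (p.2 - p'.2) / ω₀ by ring, abs_div, abs_of_pos hω₀,
      div_eq_inv_mul, one_div]
    gcongr
    rw [← Real.dist_eq, Prod.dist_eq]
    exact le_max_right _ _
  have hL2 : LipschitzWith (Real.toNNReal (K / (2 * ω₀))) fun p : ℝ × ℝ => -(deriv q p.1) / (2 * ω₀) := by
    refine LipschitzWith.of_dist_le_mul fun p p' => ?_
    rw [Real.coe_toNNReal _ (by positivity), Real.dist_eq,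
      show -deriv q p.1 / (2 * ω₀) - -deriv q p'.1 / (2 * ω₀)
        = -((deriv q p.1 - deriv q p'.1) / (2 * ω₀)) by ring, abs_neg, abs_div,
      abs_of_pos (by positivity : (0:ℝ) < 2 * ω₀), div_mul_eq_mul_div,
      div_le_div_iff_of_pos_right (by positivity : (0:ℝ) < 2 * ω₀)]
    have h := hK.dist_le_mul p.1 p'.1
    rw [Real.dist_eq] at h
    have h1 : dist p.1 p'.1 ≤ dist p p' := by rw [Prod.dist_eq]; exact le_max_left _ _
    exact h.trans (mul_le_mul_of_nonneg_left h1 K.2)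
  have hL := hL1.prodMk hL2
  obtain ⟨γ, hγ0, hγ⟩ := exists_solution_real_of_lipschitz hL (X₀, ξ₀)
  set X : ℝ → ℝ := fun t => (γ t).1 with hX
  set ξ : ℝ → ℝ := fun t => (γ t).2 with hξ
  have hX' : ∀ t, HasDerivAt X (ξ t / ω₀) t := fun t => (hγ t).fst
  have hξ' : ∀ t, HasDerivAt ξ (-(deriv q (X t)) / (2 * ω₀)) t := fun t => (hγ t).snd
  -- conservation of `ξ² + q(X)`
  have hcons : ∀ t, ξ t ^ 2 + q (X t) = ξ₀ ^ 2 + q X₀ := by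
    have hd : ∀ t, HasDerivAt (fun t => ξ t ^ 2 + q (X t)) 0 t := by
      intro t
      have h := ((hξ' t).pow 2).add ((hdq (X t)).comp t (hX' t))
      refine h.congr_deriv ?_
      simp only [Nat.cast_ofNat]
      field_simp
      ring
    intro t
    have h := is_const_of_deriv_eq_zero (fun t => (hd t).differentiableAt) (fun t => (hd t).deriv) t 0
    rw [h]
    simp [hX, hξ, hγ0]
  -- regularity
  have hXc : Continuous X := continuous_iff_continuousAt.2 fun t => (hX' t).continuousAt
  have hξc : Continuous ξ := continuous_iff_continuousAt.2 fun t => (hξ' t).continuousAt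
  have hdX : deriv X = fun t => ξ t / ω₀ := funext fun t => (hX' t).deriv
  have hdξ : deriv ξ = fun t => -(deriv q (X t)) / (2 * ω₀) := funext fun t => (hξ' t).deriv
  have hX1 : ContDiff ℝ 1 X := by
    rw [contDiff_one_iff_deriv, hdX]
    exact ⟨fun t => (hX' t).differentiableAt, by fun_prop⟩
  have hξ1 : ContDiff ℝ 1 ξ := by
    rw [contDiff_one_iff_deriv, hdξ]
    exact ⟨fun t => (hξ' t).differentiableAt, (hq1.continuous.comp hXc).neg.div_const _⟩
  have hX2 : ContDiff ℝ 2 X := by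
    rw [show (2 : WithTop ℕ∞) = 1 + 1 from rfl, contDiff_succ_iff_deriv, hdX]
    exact ⟨fun t => (hX' t).differentiableAt, by simp, hξ1.div_const _⟩
  have hξ2 : ContDiff ℝ 2 ξ := by
    rw [show (2 : WithTop ℕ∞) = 1 + 1 from rfl, contDiff_succ_iff_deriv, hdξ]
    exact ⟨fun t => (hξ' t).differentiableAt, by simp, (hq1.comp hX1).neg.div_const _⟩
  exact ⟨X, ξ, by simp [hX, hγ0], by simp [hξ, hγ0], hX', hξ', hcons, hX2, hξ2⟩

/-! ### Quadrature: primitives of `C¹` functions are `C²` -/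

/-- The primitive `t ↦ ∫₀ᵗ c` of a continuous function has derivative `c`. [folklore] -/
theorem hasDerivAt_primitive {E : Type*} [NormedAddCommGroup E] [NormedSpace ℝ E] [CompleteSpace E]
    {c : ℝ → E} (hc : Continuous c) (t : ℝ) :
    HasDerivAt (fun u => ∫ s in (0:ℝ)..u, c s) (c t) t :=
  (hc.integral_hasStrictDerivAt 0 t).hasDerivAt

/-- The primitive of a `C¹` function is `C²`. [folklore] -/
theorem contDiff_two_primitive {E : Type*} [NormedAddCommGroup E] [NormedSpace ℝ E]
    [CompleteSpace E] {c : ℝ → E} (hc : ContDiff ℝ 1 c) :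
    ContDiff ℝ 2 fun u => ∫ s in (0:ℝ)..u, c s := by
  have hd : deriv (fun u => ∫ s in (0:ℝ)..u, c s) = c :=
    funext fun t => (hasDerivAt_primitive hc.continuous t).deriv
  rw [show (2 : WithTop ℕ∞) = 1 + 1 from rfl, contDiff_succ_iff_deriv, hd]
  exact ⟨fun t => (hasDerivAt_primitive hc.continuous t).differentiableAt, by simp, hc⟩

/-! ### The full set of phase functions for a rest packet -/

/-- **Phase functions of a Gaussian beam at rest at `t = 0`.** Let `q ∈ C³` with `q'`
Lipschitz, `q(X₀) > 0`, `β₀ > 0`, `a₀ ∈ ℂ`, and `ω₀ = √(q X₀)`. There are `C²` functions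
`X ξ θ : ℝ → ℝ`, `Γ a : ℝ → ℂ` with `X 0 = X₀`, `ξ 0 = 0`, `θ 0 = 0`, `Γ 0 = iβ₀`, `a 0 = a₀`,
solving Hamilton's equations at frequency `ω₀` with the constraint `ξ² + q(X) = ω₀²`, the beam
Riccati equation `ω₀Γ' = (ξ' − ΓX')² − Γ² − ½q''(X)` with `Im Γ > 0`, the transport equation
`2ω₀a' = −((ξ' − ΓX')X' + Γ)a` and `θ' = −ω₀ + ξX'`; at `t = 0`: `X'(0) = 0`,
`a'(0) = −iβ₀a₀/(2ω₀)` and `Γ'(0) = (ξ'(0)² + β₀² − ½q''(X₀))/ω₀` is real.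
[cite: Ralston1982, §2; Sbierski2015, §3 (arXiv §2.2)] -/
theorem exists_beamPhase (hq : ContDiff ℝ 3 q) {K : ℝ≥0} (hK : LipschitzWith K (deriv q))
    {X₀ : ℝ} (hX₀ : 0 < q X₀) {β₀ : ℝ} (hβ₀ : 0 < β₀) (a₀ : ℂ) :
    ∃ (X ξ θ : ℝ → ℝ) (Γ a : ℝ → ℂ),
      X 0 = X₀ ∧ ξ 0 = 0 ∧ θ 0 = 0 ∧ Γ 0 = (β₀ : ℂ) * I ∧ a 0 = a₀ ∧
      ContDiff ℝ 2 X ∧ ContDiff ℝ 2 ξ ∧ ContDiff ℝ 2 θ ∧ ContDiff ℝ 2 Γ ∧ ContDiff ℝ 2 a ∧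
      (∀ t, deriv X t = ξ t / Real.sqrt (q X₀)) ∧
      (∀ t, deriv ξ t = -(deriv q (X t)) / (2 * Real.sqrt (q X₀))) ∧
      (∀ t, ξ t ^ 2 + q (X t) = Real.sqrt (q X₀) ^ 2) ∧
      (∀ t, deriv θ t = -Real.sqrt (q X₀) + ξ t * deriv X t) ∧
      (∀ t, (Real.sqrt (q X₀) : ℂ) * deriv Γ t
          = (((deriv ξ t : ℝ) : ℂ) - Γ t * ((deriv X t : ℝ) : ℂ)) ^ 2 - Γ t ^ 2
            - ((iteratedDeriv 2 q (X t) / 2 : ℝ) : ℂ)) ∧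
      (∀ t, 0 < (Γ t).im) ∧
      (∀ t, 2 * (Real.sqrt (q X₀) : ℂ) * deriv a t
          = -((((deriv ξ t : ℝ) : ℂ) - Γ t * ((deriv X t : ℝ) : ℂ)) * ((deriv X t : ℝ) : ℂ) + Γ t) * a t) ∧
      deriv X 0 = 0 ∧
      deriv a 0 = -((β₀ : ℂ) * I) * a₀ / (2 * Real.sqrt (q X₀)) ∧
      (deriv Γ 0).im = 0 := by
  set ω₀ : ℝ := Real.sqrt (q X₀) with hω₀def
  have hω₀ : 0 < ω₀ := Real.sqrt_pos.2 hX₀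
  have hω₀ne : (ω₀ : ℂ) ≠ 0 := by exact_mod_cast hω₀.ne'
  have hq2 : ContDiff ℝ 2 q := hq.of_le (by norm_num)
  have hdq1 : ContDiff ℝ 2 (deriv q) := hq.deriv'
  have hddq : ContDiff ℝ 1 (iteratedDeriv 2 q) := by
    rw [iteratedDeriv_succ, iteratedDeriv_one]; exact hdq1.deriv'
  obtain ⟨X, ξ, hX0, hξ0, hX', hξ', hcons, hX2, hξ2⟩ := exists_beamTrajectory hq2 hK hω₀ X₀ 0
  have hdX : ∀ t, deriv X t = ξ t / ω₀ := fun t => (hX' t).deriv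
  have hdξ : ∀ t, deriv ξ t = -(deriv q (X t)) / (2 * ω₀) := fun t => (hξ' t).deriv
  have hcons' : ∀ t, ξ t ^ 2 + q (X t) = ω₀ ^ 2 := fun t => by
    rw [hcons t, hω₀def, Real.sq_sqrt hX₀.le]; ring
  have hX1 : ContDiff ℝ 1 X := hX2.of_le (by norm_num)
  have hξ1 : ContDiff ℝ 1 ξ := hξ2.of_le (by norm_num)
  have hdX1 : ContDiff ℝ 1 (deriv X) := hX2.deriv'
  have hdξ1 : ContDiff ℝ 1 (deriv ξ) := hξ2.deriv'
  -- the Riccati coefficients of the linearised Hamilton flow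
  set A : ℝ → ℝ := fun t => iteratedDeriv 2 q (X t) / (2 * ω₀) - deriv q (X t) ^ 2 / (4 * ω₀ ^ 3)
    with hA
  set B : ℝ → ℝ := fun t => -(ξ t * deriv q (X t)) / (2 * ω₀ ^ 3) with hB
  set C : ℝ → ℝ := fun t => q (X t) / ω₀ ^ 3 with hC
  have hA1 : ContDiff ℝ 1 A := ((hddq.comp hX1).div_const _).sub
    (((hdq1.of_le (by norm_num)).comp hX1).pow 2 |>.div_const _)
  have hB1 : ContDiff ℝ 1 B :=
    (hξ1.mul ((hdq1.of_le (by norm_num)).comp hX1)).neg.div_const _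
  have hC1 : ContDiff ℝ 1 C := ((hq.of_le (by norm_num)).comp hX1).div_const _
  have hΓ₀ : 0 < ((β₀ : ℂ) * I).im := by simpa using hβ₀
  obtain ⟨Γ, hΓ0, hΓ2, hΓ', hΓim⟩ := exists_complexRiccati_im_pos_C2 hA1 hB1 hC1 hΓ₀
  -- the Riccati equation in beam form
  have hric : ∀ t, (ω₀ : ℂ) * deriv Γ t
      = (((deriv ξ t : ℝ) : ℂ) - Γ t * ((deriv X t : ℝ) : ℂ)) ^ 2 - Γ t ^ 2
        - ((iteratedDeriv 2 q (X t) / 2 : ℝ) : ℂ) := by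
    intro t
    rw [(hΓ' t).deriv, hdξ t, hdX t]
    have hc : (q (X t) : ℂ) = (ω₀ : ℂ) ^ 2 - (ξ t : ℂ) ^ 2 := by
      have := hcons' t
      have h' : q (X t) = ω₀ ^ 2 - ξ t ^ 2 := by linarith
      rw [h']; push_cast; ring
    simp only [hA, hB, hC]
    push_cast
    rw [hc]
    field_simp
    ring
  -- transport and `θ` by quadrature
  set c : ℝ → ℂ := fun t =>
    -((((deriv ξ t : ℝ) : ℂ) - Γ t * ((deriv X t : ℝ) : ℂ)) * ((deriv X t : ℝ) : ℂ) + Γ t) / (2 * ω₀) with hc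
  have hofR : ContDiff ℝ 1 fun x : ℝ => (x : ℂ) := Complex.ofRealCLM.contDiff
  have hc1 : ContDiff ℝ 1 c := by
    have h1 : ContDiff ℝ 1 fun t => ((deriv ξ t : ℝ) : ℂ) := hofR.comp hdξ1
    have h2 : ContDiff ℝ 1 fun t => ((deriv X t : ℝ) : ℂ) := hofR.comp hdX1
    exact (((h1.sub ((hΓ2.of_le (by norm_num)).mul h2)).mul h2).add
      (hΓ2.of_le (by norm_num))).neg.div_const _
  set Ic : ℝ → ℂ := fun t => ∫ s in (0:ℝ)..t, c s with hIc
  set a : ℝ → ℂ := fun t => a₀ * Complex.exp (Ic t) with ha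
  have hIc' : ∀ t, HasDerivAt Ic (c t) t := fun t => hasDerivAt_primitive hc1.continuous t
  have ha' : ∀ t, HasDerivAt a (c t * a t) t := by
    intro t
    have h := ((hIc' t).cexp).const_mul a₀
    refine h.congr_deriv ?_
    simp only [ha]; ring
  have ha2 : ContDiff ℝ 2 a := contDiff_const.mul (Complex.contDiff_exp.comp (contDiff_two_primitive hc1))
  set θ : ℝ → ℝ := fun t => ∫ s in (0:ℝ)..t, (-ω₀ + ξ s * deriv X s) with hθ
  have hθint : ContDiff ℝ 1 fun s => -ω₀ + ξ s * deriv X s := contDiff_const.add (hξ1.mul hdX1)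
  have hθ' : ∀ t, HasDerivAt θ (-ω₀ + ξ t * deriv X t) t := fun t =>
    hasDerivAt_primitive hθint.continuous t
  have hθ2 : ContDiff ℝ 2 θ := contDiff_two_primitive hθint
  -- values at `t = 0`
  have hdX0 : deriv X 0 = 0 := by rw [hdX, hξ0, zero_div]
  have hc0 : c 0 = -((β₀ : ℂ) * I) / (2 * ω₀) := by
    simp only [hc, hdX0, hΓ0]; push_cast; ring
  have hda0 : deriv a 0 = -((β₀ : ℂ) * I) * a₀ / (2 * ω₀) := by
    rw [(ha' 0).deriv, hc0]
    simp only [ha, hIc, intervalIntegral.integral_same, Complex.exp_zero, mul_one]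
    ring
  have hdΓ0 : (deriv Γ 0).im = 0 := by
    have h := hric 0
    rw [hdX0, hΓ0, hX0] at h
    have h' : deriv Γ 0 = ((((deriv ξ 0 : ℝ) : ℂ)) ^ 2 + (β₀ : ℂ) ^ 2
        - ((iteratedDeriv 2 q X₀ / 2 : ℝ) : ℂ)) / ω₀ := by
      rw [eq_div_iff hω₀ne, mul_comm, h]
      push_cast
      rw [mul_zero, sub_zero, mul_pow, Complex.I_sq]
      ring
    rw [h']
    have : ((((deriv ξ 0 : ℝ) : ℂ)) ^ 2 + (β₀ : ℂ) ^ 2 - ((iteratedDeriv 2 q X₀ / 2 : ℝ) : ℂ)) / ω₀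
        = (((deriv ξ 0) ^ 2 + β₀ ^ 2 - iteratedDeriv 2 q X₀ / 2) / ω₀ : ℝ) := by
      push_cast; ring
    rw [this, Complex.ofReal_im]
  refine ⟨X, ξ, θ, Γ, a, hX0, hξ0, by simp [hθ], hΓ0, by simp [ha, hIc], hX2, hξ2, hθ2, hΓ2, ha2,
    hdX, hdξ, hcons', fun t => (hθ' t).deriv, hric, hΓim, fun t => ?_, hdX0, hda0, hdΓ0⟩
  rw [(ha' t).deriv]
  simp only [hc]
  field_simp

end Literature.Analysis.ODE
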